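import Summits.ResolutionOfSingularities.ResolutionOfSingularities.Theorems.WildQuotientsSummitReductionStubPairQuasiSplitNormalFormLemmas3
import Summits.ResolutionOfSingularities.ResolutionOfSingularities.Theorems.WildQuotientsSummitReductionStubPairQuasiSplitNormalFormLemmas7
import Summits.ResolutionOfSingularities.ResolutionOfSingularities.Theorems.WildQuotientsSummitReductionStubPairQuasiSplitNormalFormLemmas8
import HarnessLib

/-!
# `WildQuotients.SummitReduction` (stmt-ResolutionOfSingularities-16324), line `FramePerfect`, skeleton v8:
# stub `stub_pair_quasiSplitNormalForm` (N) — helper file 9: de Jong 1997, 5.11 ¶2, "as `D` is `G`-strict,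
# `⋃ g(E_α)` is a disjoint union of components `E_β`" — translates of a singular component through a
# common point have the same germ

Route `ResolutionOfSingularities/WildQuotients`, crux `SummitReduction`; sub-goals of the registered
stub `stub_pair_quasiSplitNormalForm` of the line skeleton `Cruxes/SummitReduction/Lines/FramePerfect.lean`
(v8, lead c4). Worker file.

De Jong 1997, p. 619: "Indeed, by the remarks at the end of [1, 3.5] we have `Sing(X) = ⋃ E_α`, with
`E_α` regular of codimension 3 in `X` mapping isomorphically to an irreducible component of some
`Dᵢ ∩ Dⱼ`. Thus, as `D` is `G`-strict, we have that `⋃_{g ∈ G} g(E_α)` is a disjoint union of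
components `E_β`. Thus the last sentence of [1, 4.25] should be replaced with: Any `G`-orbit of a
component of the singular locus of `X` is nonsingular." Rendered for the quasi-split `G`-semi-stable
pairs of the line over an arbitrary field (the singular locus being closed), at the level of the
local rings of the reduced closed subscheme on `T = ⋃_g g(Ē)`:

* `stalkIdeal_component_eq_of_translate` — **translates of a singular component through a common
  point have the same germ**: if `E' = g(E)` and `x₀ ∈ Ē ∩ Ē'` is closed, then `I_{E,x₀} = I_{E',x₀}`.
  Both are minimal non-regular primes of `𝒪_{X,x₀}`; their traces `{i | f^#(tᵢ) ∈ I}` on a regular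
  system of parameters of `𝒪_{Y,f x₀}` adapted to `D` agree — `f^#(tᵢ) ∈ I_{E,x₀}` iff the generic
  point `ξ` of `Ē` lies over the component `Dᵢ` of `D` with local equation `tᵢ`, the generic point of
  `Ē'` is `g ξ`, lying over `g(f ξ)`, and `G`-strictness of `D` gives `f ξ ∈ Dᵢ ↔ g(f ξ) ∈ Dᵢ`
  (`image_mem_of_strict`) — so they coincide (`eq_of_minimal_of_forall_mem_iff`);
The orbit field itself ("Any `G`-orbit of a component of the singular locus of `X` is nonsingular")
is assembled from this and `isRegularLocalRing_quotient_component_of_quasiSplit` in the stub file.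
-/

set_option linter.dupNamespace false

noncomputable section

open CategoryTheory CategoryTheory.Limits AlgebraicGeometry TopologicalSpace Topology
open Literature.AlgebraicGeometry.Resolution
open Literature.AlgebraicGeometry
open IsLocalRing Scheme.IdealSheafData DeJong1996

namespace Summit.ResolutionOfSingularities.ResolutionOfSingularities.Theorems

/-! ## Translates of a singular component through a common point have the same germ -/

/-- **de Jong 1997, 5.11 ¶2: "as `D` is `G`-strict, `⋃_{g ∈ G} g(E_α)` is a disjoint union of
components `E_β`" — germ form.** For the curve `f : X → Y` of a quasi-split `G`-semi-stable pair
over an arbitrary field (pair in Situation 4.23, `G` acting compatibly on `X` and `Y`, `D`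
`G`-strict, `codim(Sing X, X) ≥ 3`, the singular locus closed), an irreducible component `E` of
`Sing(X)`, its translate `E' = g(E)`, and a point `x₀ ∈ Ē ∩ Ē'`: `I_{E,x₀} = I_{E',x₀}`. See
the module docstring for the proof. [cite: DeJong1997, proof of Prop. 5.11, p. 619]
[cite: DeJong1996, 3.5 and 7.1, pp. 64, 87] -/
theorem stalkIdeal_component_eq_of_translate (k : Type) [Field k] (X Y : Scheme.{0}) [IsIntegral X]
    [IsIntegral Y] (f : X ⟶ Y) (q : Y ⟶ Spec (.of k)) (D : Set Y) (G : Type) [Group G] [Finite G]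
    (ρX : G →* Aut X) (ρY : G →* Aut Y) (hρf : ∀ g : G, (ρX g).hom ≫ f = f ≫ (ρY g).hom)
    (hDstrict : ∀ (g : G) (C : Set Y), Maximal (fun C : Set Y => IsIrreducible C ∧ C ⊆ D) C →
      (C ∩ (ρY g).hom.base '' C).Nonempty → (ρY g).hom.base '' C = C)
    (m : ℕ) (τ : Fin m → (Y ⟶ X)) (hS : DeJong1996.SemiStablePair f q D τ)
    (hqs : ∀ x : X, (¬ ∃ U : X.Opens, x ∈ U ∧ Smooth (U.ι ≫ f)) →
        ∃ e : AdicCompletion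
            ((IsLocalRing.maximalIdeal (X.presheaf.stalk x)).map (Ideal.Quotient.mk
              ((IsLocalRing.maximalIdeal (Y.presheaf.stalk (f.base x))).map (f.stalkMap x).hom)))
            (X.presheaf.stalk x ⧸
              (IsLocalRing.maximalIdeal (Y.presheaf.stalk (f.base x))).map (f.stalkMap x).hom) ≃+*
          MvPowerSeries (Fin 2) (Y.presheaf.stalk (f.base x) ⧸ IsLocalRing.maximalIdeal (Y.presheaf.stalk (f.base x))) ⧸
            Ideal.span {(MvPowerSeries.X 0 * MvPowerSeries.X 1 :
              MvPowerSeries (Fin 2) (Y.presheaf.stalk (f.base x) ⧸ IsLocalRing.maximalIdeal (Y.presheaf.stalk (f.base x))))},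
          e.toRingHom.comp ((algebraMap (X.presheaf.stalk x ⧸
              (IsLocalRing.maximalIdeal (Y.presheaf.stalk (f.base x))).map (f.stalkMap x).hom) _).comp
            (Ideal.quotientMap ((IsLocalRing.maximalIdeal (Y.presheaf.stalk (f.base x))).map (f.stalkMap x).hom)
              (f.stalkMap x).hom Ideal.le_comap_map)) =
          algebraMap (Y.presheaf.stalk (f.base x) ⧸ IsLocalRing.maximalIdeal (Y.presheaf.stalk (f.base x))) _)
    (hcodim : ∀ x : X, ¬ IsRegularLocalRing (X.presheaf.stalk x) →
      (3 : WithBot ℕ∞) ≤ ringKrullDim (X.presheaf.stalk x))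
    (hSc : IsClosed ({x : X | ¬ IsRegularLocalRing (X.presheaf.stalk x)} : Set X))
    {E E' : Set ↥({x : X | ¬ IsRegularLocalRing (X.presheaf.stalk x)} : Set X)}
    (hE : E ∈ irreducibleComponents ↥({x : X | ¬ IsRegularLocalRing (X.presheaf.stalk x)} : Set X))
    (hE' : E' ∈ irreducibleComponents ↥({x : X | ¬ IsRegularLocalRing (X.presheaf.stalk x)} : Set X))
    (g : G) (hEE' : Subtype.val '' E' = (ρX g).hom.base '' (Subtype.val '' E))
    {x₀ : X} (hx₀E : x₀ ∈ closure (Subtype.val '' E)) (hx₀E' : x₀ ∈ closure (Subtype.val '' E')) :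
    stalkIdeal (singularComponentIdeal E) x₀ = stalkIdeal (singularComponentIdeal E') x₀ := by
  classical
  haveI := hS.isNoetherian
  haveI := hS.locallyOfFiniteType
  -- `x₀` is singular, so `f` is not smooth at `x₀`: the quasi-split datum at `x₀`
  have hsub : closure (Subtype.val '' E) ⊆
      ({x : X | ¬ IsRegularLocalRing (X.presheaf.stalk x)} : Set X) :=
    closure_minimal (by rintro _ ⟨z, -, rfl⟩; exact z.2) hSc
  have hreg : ¬ IsRegularLocalRing (X.presheaf.stalk x₀) := hsub hx₀E
  have hns : ∀ U : X.Opens, x₀ ∈ U → ¬ Smooth (U.ι ≫ f) :=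
    hS.not_smooth_of_not_isRegularLocalRing hreg
  obtain ⟨e₁, he₁⟩ := hqs x₀ (fun ⟨U, hU, hsm⟩ => hns U hU hsm)
  -- a regular system of parameters of `𝒪_{Y,f x₀}` adapted to `D`, on one index set
  obtain ⟨r, e₀, t, s, hdimA, hspanA, hIA, -⟩ := hS.exists_rsop_stalkIdeal_base (f x₀)
  set w : Fin (r + e₀) → Y.presheaf.stalk (f x₀) := Fin.append t s with hw
  have hspanW : Ideal.span (Set.range w) = maximalIdeal (Y.presheaf.stalk (f x₀)) := by
    rw [hw, range_fin_append, hspanA]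
  have hIW : stalkIdeal (vanishingIdeal ⟨D, hS.isStrictNormalCrossingsDivisor.isClosed⟩) (f x₀) =
      Ideal.span {∏ i ∈ Finset.univ.filter (fun i : Fin (r + e₀) => i.val < r), w i} := by
    rw [hIA, hw, Fin.prod_filter_lt_append]
  -- the quasi-split nodal structure at `x₀` (common to `E` and `E'`), `νᵢ ≤ 1`, G-ring
  obtain ⟨ν, e, hν, he⟩ := exists_formalNodeRing_equiv_of_quasiSplit hS e₁ he₁ w hspanW hdimA hIW
  clear he₁ e₁
  have hν1 : ∀ i, ν i ≤ 1 := fun i => exponent_le_one_of_codimThree hS hcodim e i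
  have hG : IsGRing (X.presheaf.stalk x₀) :=
    isGRing_stalk_of_polynomial Matsumura1987_32_polynomial_holds (f ≫ q) x₀
  -- the two minimal non-regular primes
  obtain ⟨hPp, hPreg, hPmin⟩ := stalkIdeal_vanishingIdeal_component hSc hE hx₀E
  obtain ⟨hP'p, hP'reg, hP'min⟩ := stalkIdeal_vanishingIdeal_component hSc hE' hx₀E'
  haveI := hPp
  haveI := hP'p
  refine eq_of_minimal_of_forall_mem_iff hG hν1 e (fun i => (f.stalkMap x₀).hom (w i)) he _ _ hPreg
    hPmin hP'reg hP'min fun i hi => ?_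
  -- an index with `νᵢ ≠ 0` is `< r`: `w i = t j`
  have hir : i.val < r := by
    by_contra h
    exact hi (hν i (not_lt.mp h))
  set j : Fin r := ⟨i.val, hir⟩ with hj
  have hwi : w i = t j := by
    have : i = Fin.castAdd e₀ j := Fin.ext rfl
    rw [this, hw, Fin.append_left]
  dsimp only
  rw [hwi]
  -- the component `D_j = cl{η}` of `D` with local equation `t_j` at `f x₀`
  haveI := hS.isRegular_base (f x₀)
  have hz : IsRsopPart t := ⟨inferInstance, e₀, s, hdimA, hspanA⟩
  obtain ⟨η, hη, hηP⟩ := exists_point_primeOfSpecializes_eq_span hz j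
  have hC := maximal_closure_of_primeOfSpecializes_eq_span hS.isStrictNormalCrossingsDivisor.isClosed
    hz hIA hη hηP
  have hy₀C : f x₀ ∈ closure ({η} : Set Y) := hη.mem_closure
  -- the generic points `ξ`, `ξ'` of `Ē`, `Ē'`; `ξ' = g ξ`
  have hZirr : IsIrreducible (closure (Subtype.val '' E)) :=
    (hE.1.image _ continuous_subtype_val.continuousOn).closure
  have hZ'irr : IsIrreducible (closure (Subtype.val '' E')) :=
    (hE'.1.image _ continuous_subtype_val.continuousOn).closure
  set ξ := hZirr.genericPoint with hξ
  set ξ' := hZ'irr.genericPoint with hξ'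
  have hξgen : IsGenericPoint ξ (closure (Subtype.val '' E)) :=
    hZirr.isGenericPoint_genericPoint isClosed_closure
  have hξ'gen : IsGenericPoint ξ' (closure (Subtype.val '' E')) :=
    hZ'irr.isGenericPoint_genericPoint isClosed_closure
  have hξx : ξ ⤳ x₀ := hξgen.specializes hx₀E
  have hξ'x : ξ' ⤳ x₀ := hξ'gen.specializes hx₀E'
  have hξ'eq : ξ' = (ρX g).hom.base ξ := by
    have h1 : IsGenericPoint ((ρX g).hom.base ξ)
        (closure ((ρX g).hom.base '' closure (Subtype.val '' E))) :=
      hξgen.image (ρX g).hom.continuous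
    have h2 : closure ((ρX g).hom.base '' closure (Subtype.val '' E)) =
        closure (Subtype.val '' E') := by
      have hc : IsClosed ((ρX g).hom.base '' closure (Subtype.val '' E)) :=
        (Scheme.homeoOfIso (ρX g)).isClosedMap _ isClosed_closure
      rw [hc.closure_eq, hEE']
      exact (Scheme.homeoOfIso (ρX g)).image_closure (Subtype.val '' E)
    rw [h2] at h1
    exact hξ'gen.eq h1
  -- `f ξ' = g (f ξ)`
  have hfξ' : f ξ' = (ρY g).hom.base (f ξ) := by
    rw [hξ'eq]
    have := congrArg (fun h => h.base ξ) (hρf g)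
    simpa using this
  -- the primes of `E`, `E'` at `x₀` are those of `ξ`, `ξ'`
  have hPξ : stalkIdeal (singularComponentIdeal E) x₀ = primeOfSpecializes hξx := by
    have hcl : (⟨closure (Subtype.val '' E), isClosed_closure⟩ : Closeds X) =
        ⟨closure {ξ}, isClosed_closure⟩ := Closeds.ext hξgen.def.symm
    change stalkIdeal (vanishingIdeal ⟨closure (Subtype.val '' E), isClosed_closure⟩) x₀ = _
    rw [hcl, stalkIdeal_vanishingIdeal_closure hξx]
  have hPξ' : stalkIdeal (singularComponentIdeal E') x₀ = primeOfSpecializes hξ'x := by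
    have hcl : (⟨closure (Subtype.val '' E'), isClosed_closure⟩ : Closeds X) =
        ⟨closure {ξ'}, isClosed_closure⟩ := Closeds.ext hξ'gen.def.symm
    change stalkIdeal (vanishingIdeal ⟨closure (Subtype.val '' E'), isClosed_closure⟩) x₀ = _
    rw [hcl, stalkIdeal_vanishingIdeal_closure hξ'x]
  -- `f^#(t_j) ∈ I_E ↔ f ξ ∈ D_j`, and the same for `E'`
  have hζ : f ξ ⤳ f x₀ := f.base.hom.map_specializes hξx
  have hζ' : f ξ' ⤳ f x₀ := f.base.hom.map_specializes hξ'x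
  have h1 : (f.stalkMap x₀).hom (t j) ∈ stalkIdeal (singularComponentIdeal E) x₀ ↔
      f ξ ∈ closure ({η} : Set Y) := by
    rw [hPξ, mem_closure_iff_mem_primeOfSpecializes hη hηP hζ,
      ← comap_stalkMap_primeOfSpecializes f hξx]
    exact Ideal.mem_comap.symm
  have h2 : (f.stalkMap x₀).hom (t j) ∈ stalkIdeal (singularComponentIdeal E') x₀ ↔
      f ξ' ∈ closure ({η} : Set Y) := by
    rw [hPξ', mem_closure_iff_mem_primeOfSpecializes hη hηP hζ',
      ← comap_stalkMap_primeOfSpecializes f hξ'x]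
    exact Ideal.mem_comap.symm
  rw [h1, h2]
  -- `G`-strictness: `f ξ ∈ D_j ↔ g (f ξ) = f ξ' ∈ D_j`
  have hinv : ∀ y : Y, (ρY g⁻¹).hom.base ((ρY g).hom.base y) = y := fun y => by
    have e1 : (ρY g⁻¹).hom = (ρY g).inv := by
      rw [map_inv, CategoryTheory.Aut.Aut_inv_def]
      rfl
    rw [e1]
    simp
  constructor
  · intro hmem
    rw [hfξ']
    refine image_mem_of_strict (ρY g) (hDstrict g) hC isClosed_closure hy₀C hmem ?_
    rw [← hfξ']
    exact hζ'
  · intro hmem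
    have hback : f ξ = (ρY g⁻¹).hom.base (f ξ') := by rw [hfξ', hinv]
    rw [hback]
    refine image_mem_of_strict (ρY g⁻¹) (hDstrict g⁻¹) hC isClosed_closure hy₀C hmem ?_
    rw [← hback]
    exact hζ

end Summit.ResolutionOfSingularities.ResolutionOfSingularities.Theorems

end
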